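/-
Copyright (c) 2026 the pub-hodgecm-mathlib formalisation cell (harness21).  Prover seat hodgecm-mathlib-K2E3-p06 (g4), Track B «K2-LIT», engine E3, unit U4 «Keys»; deal (D61)
LINE LEAD of the open leaf (U4f-χ₁-ram-one), design D-I v2, plan step Z2A-4 «BRANCH A: A TYPE VECTOR IS NOT KILLED BY THE INTERTWINING FUNCTIONAL» — generic composition of
★ Z2-gen (support of a type vector) and ★ Z2A-3 (5) (the functional sees only `N̄ ∩ I`); 2026-09-04.  KERNEL module: THEOREMS ONLY (no definition, no named fact, no `sorry`,
no instance, no notation).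
-/
import Summits.HodgeConjecture.HodgeConjecture.Theorems.K2E3TypeVectorSupport             -- ★ Z2-gen p858198 (this seat): `toFun_eq_zero_on_doubleCoset`, `toFun_mul_eq_of_eigen`
import Summits.HodgeConjecture.HodgeConjecture.Theorems.K2E3VanishingFunctionalLowerCell   -- ★ Z2A-3 (5) p858309 (this seat): `integral_conj_ne_zero`
import HarnessLib

/-!
# K2 ∕ E3 «EllipticInputs», unit U4 «Keys» — (U4f-χ₁-ram-one) step Z2A-4: IN BRANCH A THE INTERTWINING FUNCTIONAL DOES NOT KILL A TYPE VECTOR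
# «`f` a `(B, θ)`-eigen-section of `Ind_H^G τ` with `f(1) ≠ 0`; `θ ≠ ʷτ` somewhere on `B ∩ w⁻¹Hw`; every `w n w` (`n ∈ N`) in `B` or in `H·w·B`; `θ = 1` on `wNw ∩ B`
#  ⟹ `∫_N f(w n w) dn = vol{n : w n w ∈ B}·f(1) ≠ 0`»   [Casselman1995 §6.4; Roche1998 §3–§4; Keys1984 §3]

Cell hodgecm-mathlib (D-0151), FLOOR 0, Track B «K2-LIT», engine E3, crux item H413 = stmt-HodgeConjecture-24833 (route `HCCMUnconditional`, no route verbs); target BY NAME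
the OPEN leaf `…K2E3EllipticInputs.U4Keys.sig_K2E3KeysThmTwoContractingRamifiedCharOne` (U4Keys ED. 7), design D-I v2, plan step Z2A (Branch A), generic part.  Author K2E3-p06 (g4),
line lead (D61).  `--supports stmt-HodgeConjecture-24833 --as helper`; THEOREMS ONLY.  NOT THE PAYER.

THE POINT.  Design D-I «vanishing functional»: if the principal series `i(χ) = Ind_P^G χδ^{1∕2}` were reducible, ★ V1 gives a `G`-stable `V ∋ f`, `f(1) ≠ 0`, on which the
intertwining functional `Λ_w(f′) = ∫_N f′(w n w) dn` vanishes, and ★ Z2A-2 + ★ V2b turn `f` into an `(I, θ)`-TYPE VECTOR `f′ ∈ V` (`b·f′ = θ(b) f′` on the Iwahori `I`,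
`f′(1) ≠ 0`).  In BRANCH A (`χ ≠ ʷχ` on `T ∩ I`, i.e. `θ(b₀) ≠ (χδ^{1∕2})(w b₀ w⁻¹)` for some `b₀ ∈ I ∩ T`) THIS FILE derives the contradiction, generically in a topological
group `G` with subgroups `H` (= `P`), `B` (= `I`), `N`, an element `w` and a one-dimensional `τ`:
(i) `f′` VANISHES on the cell `H·w·B` (★ Z2-gen `toFun_eq_zero_on_doubleCoset` with the disagreeing `b₀`); (ii) on `B` it is `θ·f′(1)`, so `= f′(1)` on `wNw ∩ B` where `θ = 1`
(★ Z2-gen `toFun_mul_eq_of_eigen` at `h = 1`); (iii) every `w n w` lies in `B` or in `H·w·B` (the dichotomy — for `U(Φ₃)` ★ Z2A-3a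
`K2E3LowerUnipotentBorelIwahori.mem_inf_or_exists_eq_borel_mul_weylLongU_mul`, transported along `eA` by ★ Z2A-3b); hence the integrand of `Λ_w(f′)` is `f′(1)·𝟙_S`,
`S = {n : w n w ∈ B}`, and ★ Z2A-3 (5) `integral_conj_ne_zero` (`N` closed, `B` compact open, `w² ∈ B`, Haar measure) gives `Λ_w(f′) ≠ 0`.
* §1 `toFun_conj_eq_apply_one` (value `f′(1)` on `wNw ∩ B`), `toFun_conj_eq_zero` (value `0` on `wNw ∩ HwB`).
* §2 **`integral_conj_toFun_ne_zero`** (`Λ_w(f′) ≠ 0`), **`false_of_typeVector_of_integral_eq_zero`** (the contradiction with `Λ_w|_V = 0`).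
HONEST LABEL: HC_CM is proved only modulo the 7 printed citations (2 remaining named inputs: hLiu418 = stmt-HodgeConjecture-24832, h413 = stmt-HodgeConjecture-24833)
until rung 0 closes; count-neutral — this file does NOT pay the leaf; no printed citation is discharged.

## References
* [Casselman1995] W. Casselman, *Introduction to the theory of admissible representations of `p`-adic reductive groups* (1995), §6.3–§6.4 (the functionals `Λ_w`, vectors supported
  on one Bruhat–Iwahori cell).
* [Roche1998] A. Roche, Ann. Sci. ÉNS (4) 31 (1998), §3–§4 (support of `χ̃`-spherical vectors: `I g I` supports one iff `χ̃ = ᵍχ̃` on `J ∩ ᵍJ`).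
* [Keys1984] D. Keys, Compositio Math. 51 (1984), §3 (intertwining operators and reducibility of unitary principal series).
-/

set_option autoImplicit false
-- the mandated namespace has the single-problem summit's repeated segment (`HodgeConjecture.HodgeConjecture`)
set_option linter.dupNamespace false

noncomputable section

open MeasureTheory

namespace Summit.HodgeConjecture.HodgeConjecture.Cruxes.H413.K2E3BranchAContradiction

open Summit.HodgeConjecture.HodgeConjecture.Cruxes.H413

variable {G : Type*} [Group G] [TopologicalSpace G] [IsTopologicalGroup G] (H : Subgroup G) (τ : Representation ℂ ↥H ℂ)

/-! ## §1 The values of a type vector on `w N w` -/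

/-- **On `wNw ∩ B` (where `θ = 1`) a `(B, θ)`-eigen-section takes the value `f(1)`** (★ Z2-gen `toFun_mul_eq_of_eigen` at `h = 1`). [cite: Roche1998, §3–§4] -/
theorem toFun_conj_eq_apply_one (B : Subgroup G) (θ : G → ℂ) (f : Representation.SmoothInd H τ)
    (heig : ∀ b ∈ B, Representation.smoothIndRep H τ b f = θ b • f) (x : G) (hx : x ∈ B) (hθ : θ x = 1) :
    f.toFun x = f.toFun 1 := by
  have h := K2E3TypeVectorSupport.toFun_mul_eq_of_eigen H τ B θ f heig 1 (Subgroup.one_mem H) x hx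
  rw [one_mul, hθ, mul_one] at h
  rw [h]
  have h1 : τ (⟨1, Subgroup.one_mem H⟩ : ↥H) = 1 := by
    rw [show (⟨1, Subgroup.one_mem H⟩ : ↥H) = 1 from rfl, map_one]
  rw [h1, Module.End.one_apply, one_mul]

/-- **On `H·w·B` a `(B, θ)`-eigen-section VANISHES** as soon as `θ(b₀) ≠ τ(w b₀ w⁻¹)` for some `b₀ ∈ B` with `w b₀ w⁻¹ ∈ H` (★ Z2-gen `toFun_eq_zero_on_doubleCoset`) — so at
`x = w n w = h·w·b′`, `f(x) = 0`. [cite: Roche1998, §3–§4] [cite: Casselman1995, §6.3] -/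
theorem toFun_conj_eq_zero (B : Subgroup G) (θ : G → ℂ) (f : Representation.SmoothInd H τ)
    (heig : ∀ b ∈ B, Representation.smoothIndRep H τ b f = θ b • f) (w b₀ : G) (hb₀ : b₀ ∈ B) (hb₀H : w * b₀ * w⁻¹ ∈ H)
    (hne : θ b₀ ≠ τ (⟨w * b₀ * w⁻¹, hb₀H⟩ : ↥H) 1) (x : G) (hx : ∃ h ∈ H, ∃ b' ∈ B, x = h * w * b') :
    f.toFun x = 0 := by
  obtain ⟨h, hh, b', hb', rfl⟩ := hx
  exact K2E3TypeVectorSupport.toFun_eq_zero_on_doubleCoset H τ B θ f heig w b₀ hb₀ hb₀H hne h hh b' hb'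

/-! ## §2 The functional does not vanish on a type vector -/

/-- **`Λ_w(f) = ∫_N f(w n w) dn ≠ 0` for a `(B, θ)`-type vector with `f(1) ≠ 0` in Branch A.**  Hypotheses: `B` compact open, `N` closed, `w² ∈ B`; `f` is `(B, θ)`-eigen with
`f(1) ≠ 0`; a disagreement `θ(b₀) ≠ τ(w b₀ w⁻¹)` (`b₀ ∈ B`, `w b₀ w⁻¹ ∈ H`); the dichotomy «`w n w ∈ B` or `w n w ∈ H·w·B`» for all `n ∈ N`; `θ = 1` on `wNw ∩ B`; `μ` positive on
opens and finite on compacta (Haar).  Then §1 makes the integrand `f(1)·𝟙_{w n w ∈ B}` and ★ Z2A-3 (5) `integral_conj_ne_zero` concludes.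
[cite: Casselman1995, §6.4] [cite: Keys1984, §3] [cite: Roche1998, §3–§4] -/
theorem integral_conj_toFun_ne_zero (N B : Subgroup G) [MeasurableSpace ↥N] [BorelSpace ↥N] (μ : Measure ↥N) [μ.IsOpenPosMeasure]
    [IsFiniteMeasureOnCompacts μ] (hN : IsClosed (N : Set G)) (hBo : IsOpen (B : Set G)) (hBc : IsCompact (B : Set G))
    (w : G) (hw : w * w ∈ B) (θ : G → ℂ) (f : Representation.SmoothInd H τ)
    (heig : ∀ b ∈ B, Representation.smoothIndRep H τ b f = θ b • f) (hf1 : f.toFun 1 ≠ 0)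
    (b₀ : G) (hb₀ : b₀ ∈ B) (hb₀H : w * b₀ * w⁻¹ ∈ H) (hne : θ b₀ ≠ τ (⟨w * b₀ * w⁻¹, hb₀H⟩ : ↥H) 1)
    (hdich : ∀ n : ↥N, w * (n : G) * w ∈ B ∨ ∃ h ∈ H, ∃ b' ∈ B, w * (n : G) * w = h * w * b')
    (hθ : ∀ n : ↥N, w * (n : G) * w ∈ B → θ (w * (n : G) * w) = 1) :
    ∫ n : ↥N, f.toFun (w * (n : G) * w) ∂μ ≠ 0 := by
  refine K2E3VanishingFunctionalLowerCell.integral_conj_ne_zero N B w μ hN hBo hBc hw f.toFun (f.toFun 1) hf1 (fun n hn => ?_) (fun n hn => ?_)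
  · exact toFun_conj_eq_apply_one H τ B θ f heig _ hn (hθ n hn)
  · rcases hdich n with h | h
    · exact absurd h hn
    · exact toFun_conj_eq_zero H τ B θ f heig w b₀ hb₀ hb₀H hne _ h

/-- **BRANCH A CONTRADICTION.**  Same hypotheses with a Haar measure on `N`; if moreover `∫_N f(w n w) dn = 0` (★ V1: the functional `Λ_w` kills the `G`-stable `V ∋ f` of a
reducible principal series) then `False` — i.e. in Branch A the principal series is IRREDUCIBLE. [cite: Casselman1995, §6.4] [cite: Keys1984, §3, §7 Thm (2)] -/
theorem false_of_typeVector_of_integral_eq_zero (N B : Subgroup G) [MeasurableSpace ↥N] [BorelSpace ↥N] (μ : Measure ↥N) [μ.IsHaarMeasure]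
    (hN : IsClosed (N : Set G)) (hBo : IsOpen (B : Set G)) (hBc : IsCompact (B : Set G))
    (w : G) (hw : w * w ∈ B) (θ : G → ℂ) (f : Representation.SmoothInd H τ)
    (heig : ∀ b ∈ B, Representation.smoothIndRep H τ b f = θ b • f) (hf1 : f.toFun 1 ≠ 0)
    (b₀ : G) (hb₀ : b₀ ∈ B) (hb₀H : w * b₀ * w⁻¹ ∈ H) (hne : θ b₀ ≠ τ (⟨w * b₀ * w⁻¹, hb₀H⟩ : ↥H) 1)
    (hdich : ∀ n : ↥N, w * (n : G) * w ∈ B ∨ ∃ h ∈ H, ∃ b' ∈ B, w * (n : G) * w = h * w * b')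
    (hθ : ∀ n : ↥N, w * (n : G) * w ∈ B → θ (w * (n : G) * w) = 1)
    (hΛ : ∫ n : ↥N, f.toFun (w * (n : G) * w) ∂μ = 0) : False :=
  integral_conj_toFun_ne_zero H τ N B μ hN hBo hBc w hw θ f heig hf1 b₀ hb₀ hb₀H hne hdich hθ hΛ

end Summit.HodgeConjecture.HodgeConjecture.Cruxes.H413.K2E3BranchAContradiction

end
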